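import Summits.SmoothPoincare4.SmoothPoincare4.Theorems.SullivanDualTargetStubStandardEnd
import Summits.SmoothPoincare4.SmoothPoincare4.Theorems.SullivanDualTargetHelperKjRadialKit
import Summits.SmoothPoincare4.SmoothPoincare4.Theorems.SullivanDualTargetHelperQrSegment
import Summits.SmoothPoincare4.SmoothPoincare4.Theorems.SullivanDualTargetHelperLinearizeImmersion
import Literature.Geometry.Symplectic.GromovR4StdModel

/-!
# SmoothPoincare4 / SullivanDual — crux `Target` (stmt-SmoothPoincare4-7823), line `kaehler-jacket`:
# the CONFORMAL JACKET of a chart-form diffeomorphism (lead c6; registered helper `helper_conformalJacketOfChartForm`)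

We prove the registered helper `helper_conformalJacketOfChartForm`, the common source of the
two converse certificates of line `kaehler-jacket` (folded apex `StarJacketAt`, file
`…HelperStarJacketOfChartForm`, and the v1 apex `stub_tightInnerSphere`, file
`…TightInnerSphereCertificate`): if `Σ ∖ p` carries a diffeomorphism `Φ` onto `ℝ⁴` agreeing with
the inverted recentred chart near `p`, then there are an inner puncture `q := Φ⁻¹ 0`, a GLOBAL
smooth immersion `F : Σ ∖ p → ℝ⁴` still agreeing with the inverted chart near `p`, an isometry `A`
and a radius `r₁ > 0` with the closed `r₁`-chart-ball about `q` inside the chart and missing `p`,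
such that `F = A⁻¹ (e_q − c)` on the open `r₁`-chart-ball about `q` (CONFORMAL-AFFINE near `q`).
Construction as in `…HelperStarJacketOfChartForm` (QR normalisation `helper_qrSegment` p134744,
linearisation `helper_linearizeImmersion2` p134759, chart kit p132421, a punctured chart-ball at `p`
avoiding the modified region via `exists_radius_avoiding_closedChartBall` p132182).

References: R. S. Palais, *Extending diffeomorphisms*, Proc. AMS 11 (1960), Thm. B [Palais1960].
-/

noncomputable section

set_option linter.dupNamespace false

open scoped Manifold ContDiff Topology
open Set Function Filter Metric
open Literature.Geometry.Kaehler (MForm IsSmoothForm IsClosedForm mextDeriv)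
open Literature.Geometry.Symplectic (punctured InPuncturedChartBall stdSymplecticForm inversion
  invertedStdForm IsSymplecticStandardNearPoint AgreesWithInvertedChartNear)
open Literature.Topology.FourManifolds (HomotopySphere)

namespace Summit.SmoothPoincare4.SmoothPoincare4.Theorems.Target.KaehlerJacket

local notation "E4" => EuclideanSpace ℝ (Fin 4)

/-! ## The conformal jacket -/

/-- **Registered helper `helper_conformalJacketOfChartForm`** (see the module docstring).
[cite: Palais1960, Thm. B] -/
theorem helper_conformalJacketOfChartForm :
    ∀ (S : HomotopySphere 4) (p : S.carrier) (Φ : (punctured p) ≃ₘ⟮𝓡 4, 𝓡 4⟯ E4),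
      AgreesWithInvertedChartNear p Φ →
      ∃ q : S.carrier, q ≠ p ∧ ∃ (F : punctured p → E4) (A : E4 ≃ₗᵢ[ℝ] E4) (r₁ : ℝ), 0 < r₁ ∧
        ContMDiff (𝓡 4) 𝓘(ℝ, E4) ∞ F ∧
        (∀ x : punctured p, Injective (mfderiv (𝓡 4) 𝓘(ℝ, E4) F x)) ∧
        AgreesWithInvertedChartNear p F ∧
        Metric.closedBall (extChartAt (𝓡 4) q q) r₁ ⊆ (extChartAt (𝓡 4) q).target ∧
        (∀ y ∈ Metric.closedBall (extChartAt (𝓡 4) q q) r₁, (extChartAt (𝓡 4) q).symm y ≠ p) ∧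
        (∀ x : punctured p, x.1 ∈ (chartAt E4 q).source →
          ‖extChartAt (𝓡 4) q x.1 - extChartAt (𝓡 4) q q‖ < r₁ →
          F x = A.symm (extChartAt (𝓡 4) q x.1 - extChartAt (𝓡 4) q q)) := by
  intro S p Φ hΦ
  classical
  -- the inner puncture `q := Φ⁻¹ 0` and the charts
  set x₀ : punctured p := Φ.symm 0 with hx₀
  set q : S.carrier := x₀.1 with hqdef
  have hq : q ≠ p := Literature.Geometry.Symplectic.mem_punctured.1 x₀.2
  set e := extChartAt (𝓡 4) q with he
  set c : E4 := e q with hc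
  set ch := chartAt E4 x₀ with hch
  have hch_apply : ∀ z : punctured p, ch z = e z.1 := fun z => rfl
  have hch_source : ∀ z : punctured p, z ∈ ch.source ↔ z.1 ∈ (chartAt E4 q).source := fun z => by
    rw [hch, TopologicalSpace.Opens.chartAt_eq, OpenPartialHomeomorph.subtypeRestr_source]
    rfl
  have hx₀src : x₀ ∈ ch.source := mem_chart_source E4 x₀
  have hchx₀ : ch x₀ = c := rfl
  have hesrc : e.source = (chartAt E4 q).source := extChartAt_source (I := 𝓡 4) q
  -- target facts of the chart of `Σ ∖ p` at `x₀`
  have htgt_src : ∀ y ∈ ch.target, (ch.symm y).1 ∈ (chartAt E4 q).source := fun y hy =>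
    (hch_source _).1 (ch.map_target hy)
  have htgt_apply : ∀ y ∈ ch.target, e (ch.symm y).1 = y := fun y hy => by
    rw [← hch_apply]
    exact ch.right_inv hy
  have htgt_esymm : ∀ y ∈ ch.target, e.symm y = (ch.symm y).1 := fun y hy => by
    have h1 : e.symm (e (ch.symm y).1) = (ch.symm y).1 :=
      e.left_inv (by rw [hesrc]; exact htgt_src y hy)
    rwa [htgt_apply y hy] at h1
  have htgt_e : ch.target ⊆ e.target := by
    intro y hy
    have h : y ∈ (chartAt E4 q).target :=
      OpenPartialHomeomorph.subtypeRestr_target_subset (chartAt E4 q) ⟨x₀⟩ (by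
        rw [hch, TopologicalSpace.Opens.chartAt_eq] at hy
        exact hy)
    rw [he, extChartAt_target]
    exact ⟨by simpa using h, mem_range_self _⟩
  -- a closed chart ball inside the target
  obtain ⟨r₄, hr₄pos, hr₄⟩ : ∃ r₄ : ℝ, 0 < r₄ ∧ Metric.closedBall c r₄ ⊆ ch.target := by
    obtain ⟨r, hr, hsub⟩ := Metric.mem_nhds_iff.1 (ch.open_target.mem_nhds (ch.map_source hx₀src))
    exact ⟨r / 2, half_pos hr, (Metric.closedBall_subset_ball (half_lt_self hr)).trans hsub⟩
  -- the chart germ of `Φ` at `q`, recentred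
  set f : E4 → E4 := fun y => Φ (ch.symm (c + y)) with hfdef
  have hf0 : f 0 = 0 := by
    show Φ (ch.symm (c + 0)) = 0
    rw [add_zero, ← hchx₀, ch.left_inv hx₀src, hx₀, Diffeomorph.apply_symm_apply]
  have hmem : ∀ y : E4, ‖y‖ < r₄ → c + y ∈ ch.target := fun y hy =>
    hr₄ (by rw [Metric.mem_closedBall, dist_eq_norm, add_sub_cancel_left]; exact hy.le)
  have hn : (∞ : WithTop ℕ∞) ≠ 0 := by simp
  have hf_at : ∀ y : E4, ‖y‖ < r₄ → ContDiffAt ℝ ∞ f y ∧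
      ∃ L : E4 →L[ℝ] E4, HasFDerivAt f L y ∧ Injective L := fun y hy => by
    have hty := hmem y hy
    have hch_symm : ContMDiffAt 𝓘(ℝ, E4) (𝓡 4) ∞ ch.symm (c + y) :=
      (contMDiffOn_chart_symm (x := x₀)).contMDiffAt (ch.open_target.mem_nhds hty)
    have hΦ' : ContMDiffAt (𝓡 4) 𝓘(ℝ, E4) ∞ Φ (ch.symm (c + y)) := Φ.contMDiff.contMDiffAt
    have hadd : ContDiff ℝ ∞ (fun y : E4 => c + y) := contDiff_const.add contDiff_id
    refine ⟨contMDiffAt_iff_contDiffAt.1 (hΦ'.comp y (hch_symm.comp y hadd.contMDiff.contMDiffAt)), ?_⟩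
    have h1 : HasMFDerivAt 𝓘(ℝ, E4) 𝓘(ℝ, E4) (fun y : E4 => c + y) y (ContinuousLinearMap.id ℝ E4) :=
      ((hasFDerivAt_id y).const_add c).hasMFDerivAt
    have h2 : HasMFDerivAt 𝓘(ℝ, E4) (𝓡 4) ch.symm (c + y)
        (mfderiv 𝓘(ℝ, E4) (𝓡 4) ch.symm (c + y)) :=
      ((mdifferentiable_chart x₀).mdifferentiableAt_symm hty).hasMFDerivAt
    have h3 : HasMFDerivAt (𝓡 4) 𝓘(ℝ, E4) Φ (ch.symm (c + y))
        (mfderiv (𝓡 4) 𝓘(ℝ, E4) Φ (ch.symm (c + y))) :=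
      (Φ.contMDiff.contMDiffAt.mdifferentiableAt (by simp)).hasMFDerivAt
    have h := h3.comp y (h2.comp y h1)
    have hf' := hasMFDerivAt_iff_hasFDerivAt.1 h
    have hsrc : c + y ∈ ch.symm.source := by
      rw [OpenPartialHomeomorph.symm_source]
      exact hty
    have hΦinj : Injective (mfderiv (𝓡 4) 𝓘(ℝ, E4) Φ (ch.symm (c + y))) :=
      (Φ.mfderivToContinuousLinearEquiv hn (ch.symm (c + y))).injective
    exact ⟨_, hf', fun v w hvw =>
      (mdifferentiable_chart x₀).symm.mfderiv_injective hsrc (hΦinj hvw)⟩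
  have hf_imm : ∀ y : E4, ‖y‖ < r₄ → ContDiffAt ℝ ∞ f y ∧ Injective (fderiv ℝ f y) :=
    fun y hy => by
    obtain ⟨hsm, L, hL, hLinj⟩ := hf_at y hy
    refine ⟨hsm, ?_⟩
    rw [hL.fderiv]
    exact hLinj
  obtain ⟨L, hL0, hLinj⟩ := (hf_at 0 (by simpa using hr₄pos)).2
  -- the QR normalisation and the linearised immersion
  obtain ⟨A, hseg⟩ := helper_qrSegment L hLinj
  obtain ⟨g, r₁, r₃, hr₁pos, hr₁₃, hr₃₄, hg_at, hg_A, hg_f⟩ :=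
    helper_linearizeImmersion2 f L A r₄ hr₄pos hf_imm hf0 hL0 hseg
  -- the jacket: `g ∘ (e − c)` on the chart ball of radius `r₄`, `Φ` elsewhere
  set V : Set (punctured p) := {x | x ∈ ch.source ∧ ‖e x.1 - c‖ < r₄} with hV
  set K₃ : Set (punctured p) := {x | x ∈ ch.source ∧ ‖e x.1 - c‖ ≤ r₃} with hK₃
  set F : punctured p → E4 := fun x => if x ∈ V then g (e x.1 - c) else Φ x with hF
  have hVopen : IsOpen V := by
    have h : IsOpen (ch.source ∩ ch ⁻¹' Metric.ball c r₄) := ch.isOpen_inter_preimage Metric.isOpen_ball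
    convert h using 1
    ext x
    simp only [hV, Set.mem_setOf_eq, Set.mem_inter_iff, Set.mem_preimage, Metric.mem_ball,
      dist_eq_norm, hch_apply]
  have hK₃V : K₃ ⊆ V := fun x hx => ⟨hx.1, lt_of_le_of_lt hx.2 hr₃₄⟩
  have hball₃ : Metric.closedBall c r₃ ⊆ e.target :=
    ((Metric.closedBall_subset_closedBall hr₃₄.le).trans hr₄).trans htgt_e
  have hK₃closed : IsClosed K₃ := by
    have hcpt : IsCompact (e.symm '' Metric.closedBall c r₃) :=
      (isCompact_closedBall c r₃).image_of_continuousOn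
        ((continuousOn_extChartAt_symm (I := 𝓡 4) q).mono hball₃)
    have hK' : K₃ = Subtype.val ⁻¹' (e.symm '' Metric.closedBall c r₃) := by
      ext x
      simp only [hK₃, Set.mem_setOf_eq, Set.mem_preimage, Set.mem_image, Metric.mem_closedBall,
        dist_eq_norm, hch_source]
      constructor
      · rintro ⟨hxs, hxn⟩
        exact ⟨e x.1, hxn, e.left_inv (by rw [hesrc]; exact hxs)⟩
      · rintro ⟨y, hy, hyx⟩
        have hyt : y ∈ e.target := hball₃ (by rwa [Metric.mem_closedBall, dist_eq_norm])
        have hsrc : e.symm y ∈ (chartAt E4 q).source := by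
          rw [← hesrc]
          exact e.map_target hyt
        rw [← hyx]
        exact ⟨hsrc, by rw [e.right_inv hyt]; exact hy⟩
    rw [hK']
    exact hcpt.isClosed.preimage continuous_subtype_val
  -- `F = Φ` off `K₃`
  have hFΦ : ∀ x : punctured p, x ∉ K₃ → F x = Φ x := fun x hx => by
    by_cases hxV : x ∈ V
    · have hgt : r₃ < ‖e x.1 - c‖ := by
        by_contra h
        exact hx ⟨hxV.1, not_lt.1 h⟩
      have h1 : F x = g (e x.1 - c) := if_pos hxV
      rw [h1, hg_f _ hgt.le]
      show Φ (ch.symm (c + (e x.1 - c))) = Φ x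
      rw [add_sub_cancel, ← hch_apply, ch.left_inv hxV.1]
    · exact if_neg hxV
  -- `F` on `V`: the chart expression `g ∘ (e − c)`
  have hFV : ∀ x ∈ V, ContMDiffAt (𝓡 4) 𝓘(ℝ, E4) ∞ F x ∧
      Injective (mfderiv (𝓡 4) 𝓘(ℝ, E4) F x) := fun x hx => by
    have hev : F =ᶠ[𝓝 x] fun z => g (e z.1 - c) :=
      Filter.eventuallyEq_of_mem (hVopen.mem_nhds hx) fun z hz => if_pos hz
    obtain ⟨hgsm, hginj⟩ := hg_at (e x.1 - c) hx.2
    have hsub : ContDiff ℝ ∞ (fun y : E4 => y - c) := contDiff_id.sub contDiff_const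
    have hG : ContDiffAt ℝ ∞ (fun y : E4 => g (y - c)) (e x.1) := hgsm.comp (e x.1) hsub.contDiffAt
    have hch_sm : ContMDiffAt (𝓡 4) 𝓘(ℝ, E4) ∞ ch x :=
      (contMDiffOn_chart (x := x₀)).contMDiffAt (ch.open_source.mem_nhds hx.1)
    have hcomp : (fun z : punctured p => g (e z.1 - c)) = (fun y : E4 => g (y - c)) ∘ ch := rfl
    refine ⟨?_, ?_⟩
    · refine ContMDiffAt.congr_of_eventuallyEq ?_ hev
      rw [hcomp]
      exact (contMDiffAt_iff_contDiffAt.2 hG).comp x hch_sm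
    · rw [hev.mfderiv_eq]
      have hGd : HasFDerivAt (fun y : E4 => g (y - c)) (fderiv ℝ g (e x.1 - c)) (e x.1) := by
        have h1 := (hgsm.differentiableAt (by simp)).hasFDerivAt.comp (e x.1)
          ((hasFDerivAt_id (e x.1)).sub_const c)
        rwa [ContinuousLinearMap.comp_id] at h1
      have hch_d : HasMFDerivAt (𝓡 4) 𝓘(ℝ, E4) ch x (mfderiv (𝓡 4) 𝓘(ℝ, E4) ch x) :=
        ((mdifferentiable_chart x₀).mdifferentiableAt hx.1).hasMFDerivAt
      have hd : HasMFDerivAt (𝓡 4) 𝓘(ℝ, E4) (fun z : punctured p => g (e z.1 - c)) x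
          ((fderiv ℝ g (e x.1 - c)).comp (mfderiv (𝓡 4) 𝓘(ℝ, E4) ch x)) := by
        rw [hcomp]
        exact hGd.hasMFDerivAt.comp x hch_d
      rw [hd.mfderiv]
      intro v w hvw
      exact (mdifferentiable_chart x₀).mfderiv_injective hx.1 (hginj hvw)
  -- `F` is a global immersion
  have hFall : ∀ x : punctured p, ContMDiffAt (𝓡 4) 𝓘(ℝ, E4) ∞ F x ∧
      Injective (mfderiv (𝓡 4) 𝓘(ℝ, E4) F x) := fun x => by
    by_cases hxK : x ∈ K₃
    · exact hFV x (hK₃V hxK)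
    · have hev : F =ᶠ[𝓝 x] (Φ : punctured p → E4) :=
        Filter.eventuallyEq_of_mem (hK₃closed.isOpen_compl.mem_nhds hxK) fun z hz => hFΦ z hz
      refine ⟨Φ.contMDiff.contMDiffAt.congr_of_eventuallyEq hev, ?_⟩
      rw [hev.mfderiv_eq]
      exact (Φ.mfderivToContinuousLinearEquiv hn x).injective
  -- a punctured chart-ball at `p` avoiding `K₃`
  obtain ⟨εΦ, hεΦ, hΦagree⟩ := hΦ
  obtain ⟨ε₀, hε₀, havoidK⟩ :=
    exists_radius_avoiding_closedChartBall p q r₃ hball₃ (fun y hy => by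
      have hyt : y ∈ ch.target := ((Metric.closedBall_subset_closedBall hr₃₄.le).trans hr₄) hy
      rw [htgt_esymm y hyt]
      exact Literature.Geometry.Symplectic.mem_punctured.1 (ch.symm y).2)
  -- assemble
  have hballr₁ : Metric.closedBall c r₁ ⊆ ch.target :=
    (Metric.closedBall_subset_closedBall (hr₁₃.le.trans hr₃₄.le)).trans hr₄
  refine ⟨q, hq, F, A, r₁, hr₁pos, fun x => (hFall x).1, fun x => (hFall x).2, ?_,
    hballr₁.trans htgt_e, ?_, ?_⟩
  · -- standard near `p`
    refine ⟨min εΦ ε₀, lt_min hεΦ hε₀, fun x hxs hxb => ?_⟩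
    have hxb' : extChartAt (𝓡 4) p x.1 ∈ Metric.ball (extChartAt (𝓡 4) p p) εΦ :=
      Metric.ball_subset_ball (min_le_left _ _) hxb
    have hxb₀ : extChartAt (𝓡 4) p x.1 ∈ Metric.ball (extChartAt (𝓡 4) p p) ε₀ :=
      Metric.ball_subset_ball (min_le_right _ _) hxb
    have hxK : x ∉ K₃ := fun hK => havoidK x.1 hxs hxb₀ ⟨(hch_source x).1 hK.1, hK.2⟩
    rw [hFΦ x hxK]
    exact hΦagree x hxs hxb'
  · -- the closed `r₁`-ball misses `p`
    intro y hy
    rw [htgt_esymm y (hballr₁ hy)]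
    exact Literature.Geometry.Symplectic.mem_punctured.1 (ch.symm y).2
  · -- conformal-affine on the open `r₁`-ball
    intro x hxs hlt
    have hxV : x ∈ V := ⟨(hch_source x).2 hxs, by linarith⟩
    have h1 : F x = g (e x.1 - c) := if_pos hxV
    rw [h1, hg_A _ hlt.le]

end Summit.SmoothPoincare4.SmoothPoincare4.Theorems.Target.KaehlerJacket

end
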